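import Mathlib
import Literature.NumberTheory.LFunctions.Zhang2022.Section4Lemma41
import Literature.NumberTheory.LFunctions.Zhang2022.Section4Lemma42Holds
import Literature.NumberTheory.LFunctions.Zhang2022.Section4Lemma43Edge
import Literature.NumberTheory.LFunctions.Zhang2022.SkeletonPartOneC
import HarnessLib

/-!
# Zhang (2022) §4: Lemma 4.3 DISCHARGED and Lemma 4.8 reduced to Prop. 2.2 (i) + Lemma 4.4 —
# the compositions of the landed edges with `lemma41_holds`, `lemma42_holds`

Topic `Literature/NumberTheory/LFunctions/Zhang2022` (Landau–Siegel audit tree; verdict-neutral;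
D-0069 campaign nodes **Z22:Lem4.3** [Z22 p.17–18, §4 Lemma 4.3, tex L947–L975] and **Z22:Lem4.8**
[Z22 p.23, §4 Lemma 4.8, tex L1282–L1288]).
Y. Zhang, *Discrete mean estimates and the Landau–Siegel zero*, arXiv:2211.02515v1 (2022)
[Zhang2022LandauSiegel] — **an unrefereed manuscript under adjudication**.

The tree holds the kernel EDGES `Skeleton.lemma43_of : Lemma41 → Lemma42 → Lemma43`
(`Section4Lemma43Edge`, Borel–Carathéodory) and
`Skeleton.lemma48_of : Prop22i → Lemma41 → Lemma42 → Lemma44 → Lemma48` (`SkeletonPartOneC`, the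
algebraic core `Section4Lemma48`), and the DISCHARGES `Skeleton.lemma41_holds` (`Section4Lemma41`)
and `Skeleton.lemma42_holds` (`Section4Lemma42Holds`). This file only composes them:

* `Skeleton.lemma43_holds : Skeleton.Lemma43` — **Lemma 4.3 (`(F′/F)(s,ψ) = O(𝓛)` on `Ω₂` for
  `ψ ∈ Ψ₁`) is a theorem of the tree**, hypothesis-free;
* `Skeleton.lemma48_of_lemma44 : Prop22i → Lemma44 → Lemma48` — Lemma 4.8 now waits only on the
  CLAIM nodes Prop. 2.2 (i) and Lemma 4.4.

No new definition, no named fact. WHAT THIS IS NOT: any statement about Theorems 1–2 of the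
manuscript or about Landau–Siegel zeros.

## References

* Y. Zhang, arXiv:2211.02515v1 (2022), §4 Lemmas 4.1–4.3, 4.8. [cite: Zhang2022LandauSiegel, §4]
-/

namespace Literature.NumberTheory.LFunctions.Zhang2022.Skeleton

/-- **Lemma 4.3 of the manuscript HOLDS as typed** (node `Skeleton.Lemma43`, DAG `Z22:Lem4.3`,
[Z22 p.17–18, tex L947–L975]): for all large `D`, every real primitive `χ (mod D)`, every `ψ ∈ Ψ₁`
and `s ∈ Ω₂`, `|(F′/F)(s,ψ)| ≤ C𝓛` — the edge `lemma43_of` (the printed proof: Lemmas 4.1, 4.2 and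
Borel–Carathéodory) fed with `lemma41_holds`, `lemma42_holds`. [cite: Zhang2022LandauSiegel, §4 Lemma 4.3] -/
theorem lemma43_holds : Lemma43 := lemma43_of lemma41_holds lemma42_holds

/-- `Lemma43` — `_holds` alias of `lemma43_holds` above under the fact's exact name (appended
2026-08-28, D-0026 bookkeeping: the proof term is the existing theorem of this file; no statement,
definition or attribute is edited; no new named fact; the ledger's debt table listed the fact
unproved). [cite: Zhang2022LandauSiegel, §4 Lemma 4.3] -/
theorem _root_.Literature.NumberTheory.LFunctions.Zhang2022.Skeleton.Lemma43_holds : Lemma43 :=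
  _root_.Literature.NumberTheory.LFunctions.Zhang2022.Skeleton.lemma43_holds

/-- **Lemma 4.8 from Proposition 2.2 (i) and Lemma 4.4 alone** (node `Skeleton.Lemma48`, DAG
`Z22:Lem4.8` [Z22 p.23, tex L1282–L1288]): the edge `lemma48_of` with its Lemma 4.1 / 4.2 inputs
discharged. [cite: Zhang2022LandauSiegel, §4 Lemma 4.8] -/
theorem lemma48_of_lemma44 (h22i : Prop22i) (h44 : Lemma44) : Lemma48 :=
  lemma48_of h22i lemma41_holds lemma42_holds h44

end Literature.NumberTheory.LFunctions.Zhang2022.Skeleton
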